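import Mathlib
import Literature.Barriers.ValiantsHypothesis.AlgebraicNaturalProofs
import Summits.ValiantsHypothesis.ValiantsHypothesis.Theorems.BarrierLeverPartitionMinorsHitByVPOrProjections
import Summits.ValiantsHypothesis.ValiantsHypothesis.Theses.BarrierLever

/-!
# Route BarrierLever — item `PartitionMinorsHitByVP` (stmt-ValiantsHypothesis-19717):
# the ADDITIVE DICHOTOMY door (candidate door of record v5) — additive table or its mirror ⇒ item 19717

Link file (`--supports stmt-ValiantsHypothesis-19717`; cell valiant-natproofs, rung V4, 𝒟-side,
prover seat val-np-p6 gen 3). Definition-free. Closes NO item: it reduces the item BY NAME to one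
purely combinatorial statement about 0/1 set families.

With `ℓ_c(S) = ω₀ c + Σ_{a∈S} ω a c` the additive door (`…AdditiveDoor.partitionMinor_hit_of_additive_mem`,
p506404) hits `(u, w)` in `SmallCircuits ℂ (h+h) 5` as soon as SOME table gives
`det [∏_{c ∈ w j} ℓ_c(u i)] ≠ 0`; by the `x ↔ y` symmetry (`…partitionMinor_hit_symm`, p507603) the same
holds if some table works for the mirrored layout `(w, u)`. Hence:

* **`partitionMinorsHitByVP_of_additiveDichotomy`** — if for every `h ≥ 2` and every injective layout
  `(u, w)` SOME additive table is nonsingular on `(u, w)` OR on `(w, u)`, then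
  `Theses.BarrierLever.PartitionMinorsHitByVP` holds (with `b = 5`, `h₀ = 2`).

STATUS OF THE HYPOTHESIS (the «ADDITIVE DICHOTOMY»; evidence memo RESIDUE-v5-p6g3.md on item 19717):
TRUE by exhaustion at `h = 3` (of the 2·Σ_r C(8,r)² ordered pairs exactly 12 fail one orientation —
the Hilbert-obstructed ones, `…AdditiveObstruction` — and none fails both); `h = 4`: exhaustive kernel-free
census kit j271868/j272612; `h = 5, 6`: 0 both-failures in 7.5·10⁵ sampled pairs. It splits into two
conjectures on set families: H1 (the Hilbert-function condition of `…AdditiveObstruction`, necessary,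
is sufficient for a generic table) and SH (no pair `(u, w)` is Hilbert-obstructed in BOTH orientations;
checked for all families at `h = 4` and for `r ≤ 5` at `h = 5`). Either may fail; a both-failing layout
would be the first member of residue v5 and would go to the cell door with additive leaves
(`…CellLeaves.partitionMinorsHitByVP_of_cellHit` with `c' = 5`).

WHAT THIS IS NOT: a proof of the hypothesis; nothing on crux 14610 or VP vs VNP.
-/

set_option linter.dupNamespace false

namespace Summit.ValiantsHypothesis.ValiantsHypothesis.Theorems.BarrierLever.AdditiveDoor

open Finset MvPolynomial
open Literature.Barriers.ValiantsHypothesis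

noncomputable section

/-- **The additive dichotomy door.** If every injective layout admits a nonsingular additive table in
one of its two orientations, item 19717 `PartitionMinorsHitByVP` holds (`b = 5`, `h₀ = 2`). -/
theorem partitionMinorsHitByVP_of_additiveDichotomy
    (hyp : ∀ h : ℕ, 2 ≤ h → ∀ (r : ℕ) (u w : Fin r → Finset (Fin h)),
      Function.Injective u → Function.Injective w →
      (∃ (ω₀ : Fin h → ℂ) (ω : Fin h → Fin h → ℂ),
        (Matrix.of fun i j : Fin r => ∏ c ∈ w j, (ω₀ c + ∑ a ∈ u i, ω a c)).det ≠ 0) ∨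
      (∃ (ω₀ : Fin h → ℂ) (ω : Fin h → Fin h → ℂ),
        (Matrix.of fun i j : Fin r => ∏ a ∈ u j, (ω₀ a + ∑ c ∈ w i, ω c a)).det ≠ 0)) :
    Summit.ValiantsHypothesis.ValiantsHypothesis.Theses.BarrierLever.PartitionMinorsHitByVP := by
  refine ⟨5, 2, fun h hh r u w hu hw => ?_⟩
  rcases hyp h hh r u w hu hw with ⟨ω₀, ω, hdet⟩ | ⟨ω₀, ω, hdet⟩
  · obtain ⟨f, hf, hd⟩ := partitionMinor_hit_of_additive_mem h hh u w ω₀ ω hdet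
    exact ⟨f, hf, hd⟩
  · obtain ⟨f, hf, hd⟩ := partitionMinor_hit_symm h 5 u w
      (partitionMinor_hit_of_additive_mem h hh w u ω₀ ω hdet)
    exact ⟨f, hf, hd⟩

/-- **Corollary (one orientation).** If every injective layout admits a nonsingular additive table,
item 19717 holds. (Recorded for by-name use; the hypothesis is FALSE as stated — `…AdditiveObstruction`
exhibits layouts where every table is singular — so only the dichotomy form above is a live door.) -/
theorem partitionMinorsHitByVP_of_additiveTables
    (hyp : ∀ h : ℕ, 2 ≤ h → ∀ (r : ℕ) (u w : Fin r → Finset (Fin h)),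
      Function.Injective u → Function.Injective w →
      ∃ (ω₀ : Fin h → ℂ) (ω : Fin h → Fin h → ℂ),
        (Matrix.of fun i j : Fin r => ∏ c ∈ w j, (ω₀ c + ∑ a ∈ u i, ω a c)).det ≠ 0) :
    Summit.ValiantsHypothesis.ValiantsHypothesis.Theses.BarrierLever.PartitionMinorsHitByVP :=
  partitionMinorsHitByVP_of_additiveDichotomy fun h hh r u w hu hw => Or.inl (hyp h hh r u w hu hw)

end

end Summit.ValiantsHypothesis.ValiantsHypothesis.Theorems.BarrierLever.AdditiveDoor
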